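import Mathlib
import HarnessLib

/-!
# Plum's existence and enclosure theorem (Newton–Kantorovich type, with an integrated majorant of
# the modulus of continuity of `F'`)

Topic `Literature/Analysis/Calculus`.  This file **proves** the abstract existence-and-enclosure theorem
used in M. Plum's computer-assisted existence proofs for nonlinear elliptic boundary value problems, in
the Banach-fixed-point form, verbatim from the survey

* S. M. Rump, *Verification methods: rigorous results using floating-point arithmetic*, Acta Numerica
  **19** (2010) 287–449 [Rump2010Verification], §16 "Verification methods for partial differential equations
  by Michael Plum, Karlsruhe", §16.1 "Abstract formulation" (author's preprint pp. 129–133; printed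
  pp. 423–427; footnote 26: "Part of the following is taken from Plum (2008)" = M. Plum, *Existence and
  multiplicity proofs for semilinear elliptic boundary value problems by computer assistance*, Jahresber.
  DMV **110** (2008) 19–54).

The setting (preprint p. 129): "Find `u ∈ X` satisfying `F(u) = 0` (16.4) with `(X, ⟨·,·⟩_X)` and
`(Y, ⟨·,·⟩_Y)` denoting two real Hilbert spaces, and `F : X → Y` some Fréchet-differentiable mapping. [...]
Let `ũ ∈ X` denote some approximate solution to (16.4) [...], and denote by `L := F'(ũ) : X → Y` (16.5) the
Fréchet derivative of `F` at `ũ` [...].  Suppose that constants `δ` and `K`, and a non-decreasing function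
`g : [0, ∞) → [0, ∞)`, are known such that
`‖F(ũ)‖_Y ≤ δ` (16.6), i.e., `δ` bounds the defect (residual) of the approximate solution `ũ` to (16.4),
`‖u‖_X ≤ K ‖L[u]‖_Y` for all `u ∈ X` (16.7), i.e., `K` bounds the inverse of the linearization `L`,
`‖F'(ũ + u) − F'(ũ)‖_{B(X,Y)} ≤ g(‖u‖_X)` for all `u ∈ X` (16.8), i.e., `g` majorizes the modulus of
continuity of `F'` at `ũ`, and `g(t) → 0` as `t → 0` (16.9)."  (p. 130:) "the operator `L` must be onto
because `L⁻¹ : Y → X` will be used. (Note that `L` is one-to-one by (16.7).) There are two alternative ways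
to do this [...] (1) The compact case. [...] (2) The dual and symmetric case. Suppose that `Y = X'` [...] we
make the additional assumption [...] `(L[u])[v] = (L[v])[u]` for all `u, v ∈ X` (16.13)."  and the theorem
(preprint p. 131, printed p. 425):

> "**Theorem 16.1.** Let `δ, K, g` satisfy conditions (16.6)–(16.9).  Suppose that some `α > 0` exists
> such that `δ ≤ α/K − G(α)` (16.14), where `G(t) := ∫₀ᵗ g(s) ds`.  Moreover, suppose that: (1) the
> compact case applies, or (2) the dual and symmetric case applies, and we have the additional condition
> `K g(α) < 1` (16.15).  Then, there exists a solution `u ∈ X` of the equation `F(u) = 0` satisfying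
> `‖u − ũ‖_X ≤ α` (16.16)."

with its proof (preprint pp. 132–133): the fixed-point operator
`T(v) := −L⁻¹[F(ũ) + {F(ũ + v) − F(ũ) − L[v]}]` (16.17) on `V := {v ∈ X : ‖v‖_X ≤ α}`, the two
remainder estimates
`‖F(ũ + v) − F(ũ) − L[v]‖_Y ≤ ∫₀¹ g(t‖v‖_X) dt · ‖v‖_X = ∫₀^{‖v‖_X} g(s) ds = G(‖v‖_X)` (16.19) and
`‖F(ũ + v) − F(ũ + ṽ) − L[v − ṽ]‖_Y ≤ g(α) ‖v − ṽ‖_X` for `v, ṽ ∈ V` (16.20), whence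
"`‖T(v)‖_X ≤ K(δ + G(‖v‖_X)) ≤ K(δ + G(α)) ≤ α`, which gives `T(v) ∈ V`" and, in case (2),
"`‖T(v) − T(ṽ)‖_X ≤ K g(α) ‖v − ṽ‖_X`, whence (16.15) shows that `T` is contractive on `V`", Banach's
fixed-point theorem.  The local-uniqueness and non-degeneracy supplements are stated as in P. J. McKenna,
F. Pacella, M. Plum, D. Roth, *A computer-assisted uniqueness proof for a semilinear elliptic boundary value
problem*, (arXiv:1210.5893) Theorem 3.1 (b) "(local uniqueness) Let `η > 0` be chosen such that (3.5)
[`= K g(α) < 1`] holds with `α + η` instead of `α`.  Then `u` solution, `‖u − ω‖ ≤ α + η ⟹ u = u_λ`" and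
(c) "(nondegeneracy) `‖u − ω‖ ≤ α ⟹ L_{(λ,u)}` [the linearization at `u`] is bijective", whose printed
proof is exactly the contraction estimate above on the larger ball, resp. a Neumann-series perturbation
of (16.7).

WHAT IS TYPED.  `X`, `Y` are real normed spaces (complete where the proof uses it; the printed Hilbert
structure is needed only to make `L` onto in case (2), which is typed separately), `F' : X → (X →L[ℝ] Y)` is a
chosen derivative with `HasFDerivAt F (F' x) x` on the closed ball `B̄_α(ũ)`, `L = F' ũ`.  Hypothesis (16.8)
is assumed only for `‖u‖ ≤ α` (the only place the printed proof uses it) and `g` is assumed non-decreasing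
only on `[0, α]` (`MonotoneOn g (Icc 0 α)`); (16.9) is not needed for Theorem 16.1 itself (it serves Remark 1,
"(16.14) is satisfied for some small `α` if `δ` is sufficiently small") and is not assumed; `α ≥ 0` replaces
`α > 0`.  Onto-ness of `L` — obtained in print from "(1) the compact case" (Fredholm alternative) or "(2) the
dual and symmetric case" — enters the main theorem as the hypothesis `Function.Surjective (F' ũ)`, and case
(2) is PROVED (`surjective_of_symmetric_of_norm_le_mul`: a bounded `L : H → H'` on a real Hilbert space with
(16.7) and (16.13) is onto, by the printed density-plus-closed-range argument), giving the verbatim case (2) of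
Theorem 16.1 as `exists_zero_of_integral_majorant_of_symmetric`.
NOT TYPED: case (1) (compact perturbation of a bijection, Schauder's fixed-point theorem, which gives
existence without (16.15) and without uniqueness) and the Fredholm alternative.

RELATION TO THE TREE.  `Literature.Analysis.Calculus.existsUnique_zero_of_newtonLike` /
`existsUnique_zero_of_radiiPolynomial` (linear bound `Z·r` on `‖I − A DF‖` over the ball),
`existsUnique_zero_of_simplifiedNewton` (Lipschitz `DF`), `NewtonKantorovich*` (Kantorovich's `h ≤ 1/2`):
with `A = L⁻¹`, `Z = K g(α)`, `Y₀ = K δ` the Newton-like theorem needs `Kδ + K g(α) α < α`, i.e.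
`δ < α/K − α g(α)`, whereas (16.14) asks only `δ ≤ α/K − ∫₀^α g` — strictly weaker since `∫₀^α g ≤ α g(α)` for
non-decreasing `g` (e.g. `g(t) = γ t`: `γα²/2` versus `γα²`); so Theorem 16.1 is not a corollary of the files
above and is proved here from the integral form (16.19) of the remainder.

## Contents (all proved; no named facts, no definitions)
* `norm_sub_sub_le_majorant_mul` : (16.20).
* `norm_sub_sub_le_integral_majorant` : (16.19), `‖F(ũ+v) − F(ũ) − L v‖ ≤ ∫₀^{‖v‖} g`.
* `eq_of_zero_of_majorant` : local uniqueness on any ball `B̄_β(ũ)` with `K g(β) < 1` (McKenna–Pacella–Plum–Roth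
  Thm 3.1 (b) with `β = α + η`).
* `exists_zero_of_integral_majorant` : Theorem 16.1, Banach-fixed-point form: (16.6), (16.7), `L` onto, (16.8)
  on the ball, (16.14), (16.15) ⟹ a zero `u` with `‖u − ũ‖ ≤ α`, unique in that ball.
* `norm_le_mul_norm_fderiv_of_majorant`, `surjective_fderiv_of_majorant`, `bijective_fderiv_of_majorant` :
  non-degeneracy on the ball (Thm 3.1 (c)): `‖x‖ ≤ K/(1 − K g(α)) ‖F'(ũ+u) x‖` and `F'(ũ+u)` bijective.
* `surjective_of_symmetric_of_norm_le_mul` : case (2), `L : H →L[ℝ] (H →L[ℝ] ℝ)` with (16.7), (16.13) is onto.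
* `exists_zero_of_integral_majorant_of_symmetric` : Theorem 16.1 in "the dual and symmetric case".

## Mathlib search
`Convex.norm_image_sub_le_of_norm_hasFDerivWithin_le'` (mean value inequality against a fixed linear map),
`intervalIntegral.integral_eq_sub_of_hasDerivAt`, `intervalIntegral.norm_integral_le_of_norm_le`,
`MonotoneOn.intervalIntegrable`, `ContractingWith.exists_fixedPoint'`, `ContinuousLinearMap.antilipschitz_of_bound`,
`AntilipschitzWith.isClosed_range`, `Submodule.orthogonal_orthogonal`, `InnerProductSpace.continuousLinearMapOfBilin`
(pattern of `IsCoercive.range_eq_top`, Lax–Milgram); no statement with an integrated modulus-of-continuity majorant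
exists in Mathlib or `Literature` (`lean search 'majorant|Plum|modulus of continuity|Kantorovich'`).

## References
* [Rump2010Verification] S. M. Rump, Acta Numerica 19 (2010) 287–449, doi:10.1017/S096249291000005X, §16.1,
  Thm. 16.1, eqs. (16.4)–(16.20) (section written by M. Plum).
* M. Plum, Jahresber. Deutsch. Math.-Verein. 110 (2008) 19–54 (the source of §16.1, footnote 26).
* P. J. McKenna, F. Pacella, M. Plum, D. Roth, J. Differential Equations 253 (2012) 2359–2381, arXiv:1210.5893, Thm. 3.1.
-/

noncomputable section

open Metric Set Filter MeasureTheory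
open scoped Topology InnerProductSpace

namespace Literature.Analysis.Calculus

variable {X Y : Type*} [NormedAddCommGroup X] [NormedSpace ℝ X]
  [NormedAddCommGroup Y] [NormedSpace ℝ Y]

omit [NormedSpace ℝ X] in
/-- `ũ + u ∈ B̄_α(ũ)` when `‖u‖ ≤ α`. [folklore] -/
private theorem add_mem_closedBall_of_norm_le {ũ u : X} {α : ℝ} (hu : ‖u‖ ≤ α) :
    ũ + u ∈ closedBall ũ α := by
  rw [mem_closedBall, dist_eq_norm, add_sub_cancel_left]
  exact hu

/-- Derivative of `u ↦ F(ũ + u)` (within any set) from the derivative of `F` at `ũ + u`. [folklore] -/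
private theorem hasFDerivWithinAt_comp_const_add {F : X → Y} {F'x : X →L[ℝ] Y} {ũ u : X}
    {s : Set X} (h : HasFDerivAt F F'x (ũ + u)) :
    HasFDerivWithinAt (fun w => F (ũ + w)) F'x s u := by
  have h1 : HasFDerivAt (fun w : X => ũ + w) (ContinuousLinearMap.id ℝ X) u :=
    (hasFDerivAt_id u).const_add ũ
  have h2 := h.comp u h1
  simp only [ContinuousLinearMap.comp_id] at h2
  exact h2.hasFDerivWithinAt

/-- **(16.20)** of [Rump2010Verification] §16.1 (proof of Thm. 16.1, preprint p. 133): if `F` is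
differentiable on `B̄_α(ũ)`, `‖F'(ũ + u) − F'(ũ)‖ ≤ g(‖u‖)` for `‖u‖ ≤ α` (16.8) and `g` is non-decreasing
on `[0, α]`, then for `‖v‖, ‖w‖ ≤ α`,
`‖F(ũ + v) − F(ũ + w) − F'(ũ)[v − w]‖ ≤ g(α) ‖v − w‖` ("(16.18) and the fact that `g` is non-decreasing
imply, for all `v, ṽ ∈ V`, ... `≤ g(α)‖v − ṽ‖_X`"; here via the mean value inequality on the convex ball).
[cite: Rump2010Verification, §16.1 eq. (16.20) (proof of Thm. 16.1)] -/
theorem norm_sub_sub_le_majorant_mul {F : X → Y} {F' : X → X →L[ℝ] Y} {ũ : X} {g : ℝ → ℝ}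
    {α : ℝ} (hF : ∀ x ∈ closedBall ũ α, HasFDerivAt F (F' x) x)
    (hg : ∀ u : X, ‖u‖ ≤ α → ‖F' (ũ + u) - F' ũ‖ ≤ g ‖u‖)
    (hmono : MonotoneOn g (Icc 0 α)) {v w : X} (hv : ‖v‖ ≤ α) (hw : ‖w‖ ≤ α) :
    ‖F (ũ + v) - F (ũ + w) - F' ũ (v - w)‖ ≤ g α * ‖v - w‖ := by
  have hα : 0 ≤ α := (norm_nonneg v).trans hv
  have hbound : ∀ u ∈ closedBall (0 : X) α, ‖F' (ũ + u) - F' ũ‖ ≤ g α := by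
    intro u hu
    have hu' : ‖u‖ ≤ α := mem_closedBall_zero_iff.1 hu
    exact (hg u hu').trans (hmono ⟨norm_nonneg u, hu'⟩ ⟨hα, le_rfl⟩ hu')
  have key := (convex_closedBall (0 : X) α).norm_image_sub_le_of_norm_hasFDerivWithin_le'
    (f := fun u => F (ũ + u)) (f' := fun u => F' (ũ + u)) (φ := F' ũ)
    (fun u hu => hasFDerivWithinAt_comp_const_add
      (hF _ (add_mem_closedBall_of_norm_le (mem_closedBall_zero_iff.1 hu))))
    hbound (mem_closedBall_zero_iff.2 hw) (mem_closedBall_zero_iff.2 hv)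
  simpa only using key

/-- **(16.19)** of [Rump2010Verification] §16.1 (proof of Thm. 16.1, preprint p. 132): under (16.8) on the
ball and `g` non-decreasing on `[0, α]`, for `‖v‖ ≤ α`,
`‖F(ũ + v) − F(ũ) − L[v]‖_Y ≤ ∫₀¹ g(t‖v‖_X) dt · ‖v‖_X = ∫₀^{‖v‖_X} g(s) ds = G(‖v‖_X)`.
Proof as printed: differentiate `t ↦ F(ũ + t v) − t L[v]` along the segment, bound the derivative by
`g(t‖v‖)‖v‖` using (16.8), integrate (fundamental theorem of calculus in the complete space `Y`) and
substitute `s = t‖v‖`. [cite: Rump2010Verification, §16.1 eq. (16.19) (proof of Thm. 16.1)] -/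
theorem norm_sub_sub_le_integral_majorant [CompleteSpace Y] {F : X → Y} {F' : X → X →L[ℝ] Y}
    {ũ : X} {g : ℝ → ℝ} {α : ℝ} (hF : ∀ x ∈ closedBall ũ α, HasFDerivAt F (F' x) x)
    (hg : ∀ u : X, ‖u‖ ≤ α → ‖F' (ũ + u) - F' ũ‖ ≤ g ‖u‖)
    (hmono : MonotoneOn g (Icc 0 α)) {v : X} (hv : ‖v‖ ≤ α) :
    ‖F (ũ + v) - F ũ - F' ũ v‖ ≤ ∫ s in (0 : ℝ)..‖v‖, g s := by
  have hα : 0 ≤ α := (norm_nonneg v).trans hv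
  have h01 : (0 : ℝ) ≤ 1 := zero_le_one
  -- the path `φ(t) = F(ũ + t v) − t L[v]` and its derivative
  set φ : ℝ → Y := fun t => F (ũ + t • v) - t • F' ũ v with hφ_def
  set φ' : ℝ → Y := fun t => F' (ũ + t • v) v - F' ũ v with hφ'_def
  have htn : ∀ t ∈ Icc (0 : ℝ) 1, ‖t • v‖ = t * ‖v‖ := fun t ht => by
    rw [norm_smul, Real.norm_eq_abs, abs_of_nonneg ht.1]
  have htα : ∀ t ∈ Icc (0 : ℝ) 1, t * ‖v‖ ≤ α := fun t ht =>
    calc t * ‖v‖ ≤ 1 * ‖v‖ := mul_le_mul_of_nonneg_right ht.2 (norm_nonneg v)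
      _ = ‖v‖ := one_mul _
      _ ≤ α := hv
  have hseg : ∀ t ∈ Icc (0 : ℝ) 1, ‖t • v‖ ≤ α := fun t ht => (htn t ht).le.trans (htα t ht)
  have hderiv : ∀ t ∈ Icc (0 : ℝ) 1, HasDerivAt φ (φ' t) t := by
    intro t ht
    have h1 : HasDerivAt (fun s : ℝ => ũ + s • v) v t := by
      simpa using ((hasDerivAt_id t).smul_const v).const_add ũ
    have h2 : HasDerivAt (fun s : ℝ => F (ũ + s • v)) (F' (ũ + t • v) v) t :=
      (hF _ (add_mem_closedBall_of_norm_le (hseg t ht))).comp_hasDerivAt t h1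
    have h3 : HasDerivAt (fun s : ℝ => s • F' ũ v) (F' ũ v) t := by
      simpa using (hasDerivAt_id t).smul_const (F' ũ v)
    exact h2.sub h3
  have hderiv_eq : ∀ t ∈ Icc (0 : ℝ) 1, deriv φ t = φ' t := fun t ht => (hderiv t ht).deriv
  -- pointwise bound `‖φ'(t)‖ ≤ g(t‖v‖) ‖v‖ ≤ g(α) ‖v‖` by (16.8)
  have hbound : ∀ t ∈ Icc (0 : ℝ) 1, ‖φ' t‖ ≤ g (t * ‖v‖) * ‖v‖ := by
    intro t ht
    calc ‖φ' t‖ = ‖(F' (ũ + t • v) - F' ũ) v‖ := by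
            simp only [hφ'_def, sub_apply]
      _ ≤ ‖F' (ũ + t • v) - F' ũ‖ * ‖v‖ := ContinuousLinearMap.le_opNorm _ _
      _ ≤ g ‖t • v‖ * ‖v‖ := mul_le_mul_of_nonneg_right (hg _ (hseg t ht)) (norm_nonneg v)
      _ = g (t * ‖v‖) * ‖v‖ := by rw [htn t ht]
  have hgα : ∀ t ∈ Icc (0 : ℝ) 1, g (t * ‖v‖) ≤ g α := fun t ht =>
    hmono ⟨mul_nonneg ht.1 (norm_nonneg v), htα t ht⟩ ⟨hα, le_rfl⟩ (htα t ht)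
  -- the derivative is (Bochner-)integrable on `[0, 1]`: measurable and bounded
  have hint : IntervalIntegrable (deriv φ) volume 0 1 := by
    have hIO : IntegrableOn (deriv φ) (Icc (0 : ℝ) 1) volume := by
      refine Measure.integrableOn_of_bounded measure_Icc_lt_top.ne
        (aestronglyMeasurable_deriv φ volume) (M := g α * ‖v‖) ?_
      rw [ae_restrict_iff' measurableSet_Icc]
      exact Eventually.of_forall fun t ht => by
        rw [hderiv_eq t ht]
        exact (hbound t ht).trans (mul_le_mul_of_nonneg_right (hgα t ht) (norm_nonneg v))
    have hIO' : IntegrableOn (deriv φ) (uIcc (0 : ℝ) 1) volume := by rwa [uIcc_of_le h01]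
    exact hIO'.intervalIntegrable
  -- fundamental theorem of calculus
  have hFTC : ∫ t in (0 : ℝ)..1, deriv φ t = φ 1 - φ 0 :=
    intervalIntegral.integral_eq_sub_of_hasDerivAt
      (fun t ht => by
        rw [uIcc_of_le h01] at ht
        exact (hderiv t ht).differentiableAt.hasDerivAt)
      hint
  have hφ0 : φ 0 = F ũ := by simp [hφ_def]
  have hφ1 : φ 1 = F (ũ + v) - F' ũ v := by simp [hφ_def]
  -- `∫₀¹ ‖φ'‖ ≤ ∫₀¹ g(t‖v‖)‖v‖ dt`
  have hmono' : MonotoneOn (fun t : ℝ => g (t * ‖v‖) * ‖v‖) (uIcc (0 : ℝ) 1) := by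
    rw [uIcc_of_le h01]
    intro s hs t ht hst
    exact mul_le_mul_of_nonneg_right
      (hmono ⟨mul_nonneg hs.1 (norm_nonneg v), htα s hs⟩ ⟨mul_nonneg ht.1 (norm_nonneg v), htα t ht⟩
        (mul_le_mul_of_nonneg_right hst (norm_nonneg v))) (norm_nonneg v)
  have hle : ‖∫ t in (0 : ℝ)..1, deriv φ t‖ ≤ ∫ t in (0 : ℝ)..1, g (t * ‖v‖) * ‖v‖ :=
    intervalIntegral.norm_integral_le_of_norm_le h01
      (Eventually.of_forall fun t ht => by
        have ht' : t ∈ Icc (0 : ℝ) 1 := Ioc_subset_Icc_self ht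
        rw [hderiv_eq t ht']
        exact hbound t ht')
      hmono'.intervalIntegrable
  -- substitution `s = t ‖v‖`
  have hsub : ∫ t in (0 : ℝ)..1, g (t * ‖v‖) * ‖v‖ = ∫ s in (0 : ℝ)..‖v‖, g s := by
    have h := intervalIntegral.smul_integral_comp_mul_right g ‖v‖ (a := 0) (b := 1)
    simp only [zero_mul, one_mul, smul_eq_mul] at h
    rw [intervalIntegral.integral_mul_const, mul_comm]
    exact h
  calc ‖F (ũ + v) - F ũ - F' ũ v‖ = ‖φ 1 - φ 0‖ := by
          rw [hφ1, hφ0]; congr 1; abel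
    _ = ‖∫ t in (0 : ℝ)..1, deriv φ t‖ := by rw [hFTC]
    _ ≤ ∫ t in (0 : ℝ)..1, g (t * ‖v‖) * ‖v‖ := hle
    _ = ∫ s in (0 : ℝ)..‖v‖, g s := hsub

/-- **Local uniqueness** (McKenna–Pacella–Plum–Roth, arXiv:1210.5893, Thm. 3.1 (b), in the abstract
setting of [Rump2010Verification] §16.1): if `F` is differentiable on `B̄_β(ũ)`, `‖u‖ ≤ K‖L[u]‖` (16.7),
(16.8) holds for `‖u‖ ≤ β` with `g` non-decreasing on `[0, β]`, and `K g(β) < 1` ((16.15) at `β`), then `F`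
has at most one zero in `B̄_β(ũ)`: for two zeros `u₁, u₂`, (16.20) gives
`‖L[u₁ − u₂]‖ ≤ g(β)‖u₁ − u₂‖`, so `‖u₁ − u₂‖ ≤ K g(β) ‖u₁ − u₂‖`.
[cite: Rump2010Verification, §16.1 Thm. 16.1 proof, (16.20) with (16.7), (16.15); arXiv:1210.5893 Thm. 3.1 (b)] -/
theorem eq_of_zero_of_majorant {F : X → Y} {F' : X → X →L[ℝ] Y} {ũ : X} {g : ℝ → ℝ} {K β : ℝ}
    (hF : ∀ x ∈ closedBall ũ β, HasFDerivAt F (F' x) x)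
    (hK : ∀ u : X, ‖u‖ ≤ K * ‖F' ũ u‖)
    (hg : ∀ u : X, ‖u‖ ≤ β → ‖F' (ũ + u) - F' ũ‖ ≤ g ‖u‖) (hmono : MonotoneOn g (Icc 0 β))
    (hKg : K * g β < 1) {u₁ u₂ : X} (hu₁ : u₁ ∈ closedBall ũ β) (hu₂ : u₂ ∈ closedBall ũ β)
    (h₁ : F u₁ = 0) (h₂ : F u₂ = 0) : u₁ = u₂ := by
  have hv₁ : ‖u₁ - ũ‖ ≤ β := mem_closedBall_iff_norm.1 hu₁
  have hv₂ : ‖u₂ - ũ‖ ≤ β := mem_closedBall_iff_norm.1 hu₂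
  have key := norm_sub_sub_le_majorant_mul hF hg hmono hv₁ hv₂
  have hsub : u₁ - ũ - (u₂ - ũ) = u₁ - u₂ := by abel
  rw [add_sub_cancel, add_sub_cancel, h₁, h₂, sub_self, zero_sub, norm_neg, hsub] at key
  -- `key : ‖L (u₁ - u₂)‖ ≤ g β * ‖u₁ - u₂‖`
  have h3 : ‖u₁ - u₂‖ ≤ K * ‖F' ũ (u₁ - u₂)‖ := hK _
  have hd : ‖u₁ - u₂‖ ≤ 0 := by
    rcases le_or_gt 0 K with hK0 | hK0
    · have h4 : ‖u₁ - u₂‖ ≤ (K * g β) * ‖u₁ - u₂‖ :=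
        calc ‖u₁ - u₂‖ ≤ K * ‖F' ũ (u₁ - u₂)‖ := h3
          _ ≤ K * (g β * ‖u₁ - u₂‖) := mul_le_mul_of_nonneg_left key hK0
          _ = (K * g β) * ‖u₁ - u₂‖ := by ring
      by_contra hn
      rw [not_le] at hn
      have h5 : (K * g β) * ‖u₁ - u₂‖ < 1 * ‖u₁ - u₂‖ := mul_lt_mul_of_pos_right hKg hn
      linarith
    · have h4 : K * ‖F' ũ (u₁ - u₂)‖ ≤ 0 :=
        mul_nonpos_of_nonpos_of_nonneg hK0.le (norm_nonneg _)
      exact h3.trans h4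
  exact sub_eq_zero.1 (norm_le_zero_iff.1 hd)

/-- A bounded linear `L : X → Y` with `‖u‖ ≤ K‖L u‖` (16.7) which is onto has a two-sided linear inverse
`M` with `‖M y‖ ≤ K‖y‖` ("`L` must be onto because `L⁻¹ : Y → X` will be used. (Note that `L` is one-to-one
by (16.7).)", [Rump2010Verification] preprint p. 130). [folklore] -/
private theorem exists_inverse_of_norm_le_mul {L : X →L[ℝ] Y} {K : ℝ}
    (hK : ∀ u : X, ‖u‖ ≤ K * ‖L u‖) (hL : Function.Surjective L) :
    ∃ M : Y →ₗ[ℝ] X, (∀ y, L (M y) = y) ∧ (∀ x, M (L x) = x) ∧ ∀ y, ‖M y‖ ≤ K * ‖y‖ := by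
  have hinj : Function.Injective L := by
    intro x₁ x₂ h
    have h' : ‖x₁ - x₂‖ ≤ K * ‖L (x₁ - x₂)‖ := hK _
    rw [map_sub, h, sub_self, norm_zero, mul_zero] at h'
    exact sub_eq_zero.1 (norm_le_zero_iff.1 h')
  let e : X ≃ₗ[ℝ] Y := LinearEquiv.ofBijective (L : X →ₗ[ℝ] Y) ⟨hinj, hL⟩
  have he : ∀ y, L (e.symm y) = y := fun y =>
    LinearEquiv.apply_ofBijective_symm_apply (L : X →ₗ[ℝ] Y) y
  refine ⟨e.symm, he, fun x => ?_, fun y => ?_⟩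
  · exact LinearEquiv.ofBijective_symm_apply_apply (L : X →ₗ[ℝ] Y) x
  · calc ‖e.symm y‖ ≤ K * ‖L (e.symm y)‖ := hK _
      _ = K * ‖y‖ := by rw [he]

/-- **Theorem 16.1 of [Rump2010Verification] (M. Plum's existence and enclosure theorem), Banach
fixed-point form.**  Let `F : X → Y` (real Banach spaces) be Fréchet differentiable on `B̄_α(ũ)` with
derivative `F'`, `L := F'(ũ)`, and suppose
(16.6) `‖F(ũ)‖ ≤ δ`;  (16.7) `‖u‖ ≤ K‖L[u]‖` for all `u`;  `L` onto (in print from "the compact case" or "the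
dual and symmetric case", see `surjective_of_symmetric_of_norm_le_mul`);  (16.8) `‖F'(ũ + u) − F'(ũ)‖ ≤ g(‖u‖)`
for `‖u‖ ≤ α` with `g` non-decreasing on `[0, α]`;  (16.14) `δ ≤ α/K − G(α)`, `G(α) = ∫₀^α g(s) ds`;  and
(16.15) `K g(α) < 1`.  "Then, there exists a solution `u ∈ X` of the equation `F(u) = 0` satisfying
`‖u − ũ‖_X ≤ α` (16.16)"; moreover (Banach's theorem / McKenna–Pacella–Plum–Roth Thm. 3.1 (b) with `η = 0`)
it is the only zero of `F` in `B̄_α(ũ)`.  Proof verbatim (preprint pp. 132–133): `T(v) = −L⁻¹[F(ũ) + {F(ũ+v)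
− F(ũ) − L[v]}]` maps `V = B̄_α(0)` into itself by (16.19) and (16.14) and is `K g(α)`-contractive there by
(16.20), Banach's fixed-point theorem. [cite: Rump2010Verification, §16.1 Thm. 16.1 (case (B)/(2), eqs. (16.14)–(16.17))] -/
theorem exists_zero_of_integral_majorant [CompleteSpace X] [CompleteSpace Y]
    {F : X → Y} {F' : X → X →L[ℝ] Y} {ũ : X} {g : ℝ → ℝ} {δ K α : ℝ} (hα : 0 ≤ α)
    (hF : ∀ x ∈ closedBall ũ α, HasFDerivAt F (F' x) x)
    (hδ : ‖F ũ‖ ≤ δ) (hK : ∀ u : X, ‖u‖ ≤ K * ‖F' ũ u‖)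
    (hL : Function.Surjective (F' ũ))
    (hg : ∀ u : X, ‖u‖ ≤ α → ‖F' (ũ + u) - F' ũ‖ ≤ g ‖u‖)
    (hmono : MonotoneOn g (Icc 0 α))
    (h₁ : δ ≤ α / K - ∫ s in (0 : ℝ)..α, g s) (h₂ : K * g α < 1) :
    ∃ u ∈ closedBall ũ α, F u = 0 ∧ ∀ u' ∈ closedBall ũ α, F u' = 0 → u' = u := by
  -- the trivial space: `ũ` itself is the zero
  rcases subsingleton_or_nontrivial X with hX | hX
  · refine ⟨ũ, mem_closedBall_self hα, ?_, fun u' _ _ => Subsingleton.elim _ _⟩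
    obtain ⟨x, hx⟩ := hL (F ũ)
    rw [← hx, Subsingleton.elim x 0, map_zero]
  -- otherwise (16.7) forces `K > 0`
  obtain ⟨w, hw⟩ := exists_ne (0 : X)
  have hKpos : 0 < K := by
    by_contra hle
    rw [not_lt] at hle
    have h1 : ‖w‖ ≤ K * ‖F' ũ w‖ := hK w
    have h2 : K * ‖F' ũ w‖ ≤ 0 := mul_nonpos_of_nonpos_of_nonneg hle (norm_nonneg _)
    exact hw (norm_le_zero_iff.1 (h1.trans h2))
  -- `g ≥ 0` on `[0, α]` (from (16.8) at `u = 0` and monotonicity)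
  have hg0 : 0 ≤ g 0 := by
    have h := hg 0 (by rw [norm_zero]; exact hα)
    rw [add_zero, sub_self, norm_zero, norm_zero] at h
    exact h
  have hgnn : ∀ t ∈ Icc (0 : ℝ) α, 0 ≤ g t := fun t ht => hg0.trans (hmono ⟨le_rfl, hα⟩ ht ht.1)
  -- `L⁻¹`
  obtain ⟨M, hLM, hML, hMK⟩ := exists_inverse_of_norm_le_mul hK hL
  -- the fixed-point operator (16.17): `T(v) = −L⁻¹[F(ũ) + {F(ũ+v) − F(ũ) − L[v]}] = v − L⁻¹ F(ũ + v)`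
  set T : X → X := fun v => v - M (F (ũ + v)) with hT
  have hT' : ∀ v, T v = -M (F ũ + (F (ũ + v) - F ũ - F' ũ v)) := by
    intro v
    simp only [hT, map_add, map_sub, hML]
    abel
  -- (i) `T(V) ⊂ V` for `V = B̄_α(0)`
  have hGmono : ∀ v : X, ‖v‖ ≤ α → ∫ s in (0 : ℝ)..‖v‖, g s ≤ ∫ s in (0 : ℝ)..α, g s := by
    intro v hv
    refine intervalIntegral.integral_mono_interval le_rfl (norm_nonneg v) hv ?_ ?_
    · rw [EventuallyLE, ae_restrict_iff' measurableSet_Ioc]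
      exact Eventually.of_forall fun t ht => hgnn t (Ioc_subset_Icc_self ht)
    · have hm : MonotoneOn g (uIcc 0 α) := by rwa [uIcc_of_le hα]
      exact hm.intervalIntegrable
  have hmaps : MapsTo T (closedBall (0 : X) α) (closedBall 0 α) := by
    intro v hv
    have hv' : ‖v‖ ≤ α := mem_closedBall_zero_iff.1 hv
    rw [mem_closedBall_zero_iff, hT' v, norm_neg]
    have hrem := norm_sub_sub_le_integral_majorant hF hg hmono hv'
    calc ‖M (F ũ + (F (ũ + v) - F ũ - F' ũ v))‖ ≤ K * ‖F ũ + (F (ũ + v) - F ũ - F' ũ v)‖ := hMK _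
      _ ≤ K * (‖F ũ‖ + ‖F (ũ + v) - F ũ - F' ũ v‖) :=
          mul_le_mul_of_nonneg_left (norm_add_le _ _) hKpos.le
      _ ≤ K * (δ + ∫ s in (0 : ℝ)..α, g s) :=
          mul_le_mul_of_nonneg_left (add_le_add hδ (hrem.trans (hGmono v hv'))) hKpos.le
      _ ≤ K * (α / K) := mul_le_mul_of_nonneg_left (by linarith) hKpos.le
      _ = α := by field_simp
  -- (ii) `T` is `K g(α)`-Lipschitz on `V` by (16.20)
  have hlip : ∀ v ∈ closedBall (0 : X) α, ∀ w ∈ closedBall (0 : X) α,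
      ‖T v - T w‖ ≤ (K * g α) * ‖v - w‖ := by
    intro v hv w hw
    have hv' : ‖v‖ ≤ α := mem_closedBall_zero_iff.1 hv
    have hw' : ‖w‖ ≤ α := mem_closedBall_zero_iff.1 hw
    have hTT : T v - T w = -M (F (ũ + v) - F (ũ + w) - F' ũ (v - w)) := by
      simp only [hT, map_sub, hML]
      abel
    rw [hTT, norm_neg]
    calc ‖M (F (ũ + v) - F (ũ + w) - F' ũ (v - w))‖
          ≤ K * ‖F (ũ + v) - F (ũ + w) - F' ũ (v - w)‖ := hMK _
      _ ≤ K * (g α * ‖v - w‖) :=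
          mul_le_mul_of_nonneg_left (norm_sub_sub_le_majorant_mul hF hg hmono hv' hw') hKpos.le
      _ = (K * g α) * ‖v - w‖ := by ring
  -- Banach's fixed-point theorem on the complete set `V`
  have hKg0 : 0 ≤ K * g α := mul_nonneg hKpos.le (hgnn α ⟨hα, le_rfl⟩)
  obtain ⟨κ, hκ⟩ : ∃ κ : NNReal, (κ : ℝ) = K * g α := ⟨⟨K * g α, hKg0⟩, rfl⟩
  have hκ1 : κ < 1 := by
    rw [← NNReal.coe_lt_coe, hκ, NNReal.coe_one]
    exact h₂
  have hlipK : LipschitzOnWith κ T (closedBall 0 α) := by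
    refine LipschitzOnWith.of_dist_le_mul fun v hv w hw => ?_
    rw [dist_eq_norm, dist_eq_norm, hκ]
    exact hlip v hv w hw
  have hc : ContractingWith κ (hmaps.restrict T _ _) := ⟨hκ1, hlipK.mapsToRestrict hmaps⟩
  obtain ⟨v, hv, hfix, -, -⟩ :=
    hc.exists_fixedPoint' isClosed_closedBall.isComplete hmaps (mem_closedBall_self hα)
      (edist_ne_top _ _)
  -- the fixed point gives the zero `u = ũ + v`
  have hMF : M (F (ũ + v)) = 0 := by
    have h : v - M (F (ũ + v)) = v := hfix
    exact sub_eq_self.1 h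
  have hFv : F (ũ + v) = 0 := by
    calc F (ũ + v) = F' ũ (M (F (ũ + v))) := (hLM _).symm
      _ = 0 := by rw [hMF, map_zero]
  refine ⟨ũ + v, add_mem_closedBall_of_norm_le (mem_closedBall_zero_iff.1 hv), hFv,
    fun u' hu' hFu' => ?_⟩
  exact eq_of_zero_of_majorant hF hK hg hmono h₂ hu'
    (add_mem_closedBall_of_norm_le (mem_closedBall_zero_iff.1 hv)) hFu' hFv

/-- **Non-degeneracy on the ball, quantitative** (McKenna–Pacella–Plum–Roth, arXiv:1210.5893, Thm. 3.1 (c),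
in the setting of [Rump2010Verification] §16.1): from (16.7) `‖x‖ ≤ K‖L x‖`, (16.8) on the ball and (16.15)
`K g(α) < 1`, for every `‖u‖ ≤ α` the linearization at `ũ + u` satisfies
`‖x‖ ≤ K/(1 − K g(α)) · ‖F'(ũ + u) x‖` (since `‖L x‖ ≤ ‖F'(ũ+u) x‖ + g(α)‖x‖`).
[cite: Rump2010Verification, §16.1 (16.7), (16.8), (16.15); arXiv:1210.5893 Thm. 3.1 (c)] -/
theorem norm_le_mul_norm_fderiv_of_majorant {F' : X → X →L[ℝ] Y} {ũ : X} {g : ℝ → ℝ} {K α : ℝ}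
    (hK : ∀ u : X, ‖u‖ ≤ K * ‖F' ũ u‖)
    (hg : ∀ u : X, ‖u‖ ≤ α → ‖F' (ũ + u) - F' ũ‖ ≤ g ‖u‖) (hmono : MonotoneOn g (Icc 0 α))
    (hKg : K * g α < 1) {u : X} (hu : ‖u‖ ≤ α) (x : X) :
    ‖x‖ ≤ K / (1 - K * g α) * ‖F' (ũ + u) x‖ := by
  have hα : 0 ≤ α := (norm_nonneg u).trans hu
  have hD : ‖F' (ũ + u) - F' ũ‖ ≤ g α :=
    (hg u hu).trans (hmono ⟨norm_nonneg u, hu⟩ ⟨hα, le_rfl⟩ hu)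
  have h1 : ‖x‖ ≤ K * ‖F' ũ x‖ := hK x
  have h2 : ‖F' ũ x‖ ≤ ‖F' (ũ + u) x‖ + g α * ‖x‖ := by
    have he : F' ũ x = F' (ũ + u) x - (F' (ũ + u) - F' ũ) x := by
      simp only [sub_apply]; abel
    calc ‖F' ũ x‖ = ‖F' (ũ + u) x - (F' (ũ + u) - F' ũ) x‖ := by rw [← he]
      _ ≤ ‖F' (ũ + u) x‖ + ‖(F' (ũ + u) - F' ũ) x‖ := norm_sub_le _ _
      _ ≤ ‖F' (ũ + u) x‖ + g α * ‖x‖ := by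
          gcongr
          exact (ContinuousLinearMap.le_opNorm _ _).trans
            (mul_le_mul_of_nonneg_right hD (norm_nonneg x))
  have hpos : 0 < 1 - K * g α := by linarith
  rcases le_or_gt 0 K with hK0 | hK0
  · rw [div_mul_eq_mul_div, le_div_iff₀ hpos]
    have h3 : ‖x‖ ≤ K * ‖F' (ũ + u) x‖ + K * g α * ‖x‖ :=
      calc ‖x‖ ≤ K * ‖F' ũ x‖ := h1
        _ ≤ K * (‖F' (ũ + u) x‖ + g α * ‖x‖) := mul_le_mul_of_nonneg_left h2 hK0
        _ = K * ‖F' (ũ + u) x‖ + K * g α * ‖x‖ := by ring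
    linarith
  · -- `K < 0` forces `x = 0`
    have h3 : ‖x‖ ≤ 0 := h1.trans (mul_nonpos_of_nonpos_of_nonneg hK0.le (norm_nonneg _))
    have hx : x = 0 := norm_le_zero_iff.1 h3
    simp [hx]

/-- **Non-degeneracy on the ball, surjectivity** (McKenna–Pacella–Plum–Roth, arXiv:1210.5893, Thm. 3.1 (c)):
with `X` complete, (16.7), `L = F'(ũ)` onto, (16.8) on the ball and `K g(α) < 1`, the linearization
`F'(ũ + u)` is onto for every `‖u‖ ≤ α` (given `y`, the map `x ↦ L⁻¹[y − (F'(ũ+u) − L) x]` is a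
`K g(α)`-contraction of `X`; its fixed point solves `F'(ũ + u) x = y`).
[cite: Rump2010Verification, §16.1 (16.7), (16.8), (16.15); arXiv:1210.5893 Thm. 3.1 (c)] -/
theorem surjective_fderiv_of_majorant [CompleteSpace X] {F' : X → X →L[ℝ] Y} {ũ : X} {g : ℝ → ℝ}
    {K α : ℝ} (hK : ∀ u : X, ‖u‖ ≤ K * ‖F' ũ u‖) (hL : Function.Surjective (F' ũ))
    (hg : ∀ u : X, ‖u‖ ≤ α → ‖F' (ũ + u) - F' ũ‖ ≤ g ‖u‖) (hmono : MonotoneOn g (Icc 0 α))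
    (hKg : K * g α < 1) {u : X} (hu : ‖u‖ ≤ α) : Function.Surjective (F' (ũ + u)) := by
  rcases subsingleton_or_nontrivial X with hX | hX
  · intro y
    obtain ⟨x, hx⟩ := hL y
    exact ⟨x, by rw [← hx, Subsingleton.elim x 0, map_zero, map_zero]⟩
  obtain ⟨w, hw⟩ := exists_ne (0 : X)
  have hKpos : 0 < K := by
    by_contra hle
    rw [not_lt] at hle
    have h1 : ‖w‖ ≤ K * ‖F' ũ w‖ := hK w
    have h2 : K * ‖F' ũ w‖ ≤ 0 := mul_nonpos_of_nonpos_of_nonneg hle (norm_nonneg _)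
    exact hw (norm_le_zero_iff.1 (h1.trans h2))
  have hα : 0 ≤ α := (norm_nonneg u).trans hu
  have hD : ‖F' (ũ + u) - F' ũ‖ ≤ g α :=
    (hg u hu).trans (hmono ⟨norm_nonneg u, hu⟩ ⟨hα, le_rfl⟩ hu)
  have hKg0 : 0 ≤ K * g α := mul_nonneg hKpos.le ((norm_nonneg _).trans hD)
  obtain ⟨M, hLM, hML, hMK⟩ := exists_inverse_of_norm_le_mul hK hL
  intro y
  set D : X →L[ℝ] Y := F' (ũ + u) - F' ũ with hDdef
  set S : X → X := fun x => M (y - D x) with hS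
  obtain ⟨κ, hκ⟩ : ∃ κ : NNReal, (κ : ℝ) = K * g α := ⟨⟨K * g α, hKg0⟩, rfl⟩
  have hκ1 : κ < 1 := by
    rw [← NNReal.coe_lt_coe, hκ, NNReal.coe_one]
    exact hKg
  have hcon : ContractingWith κ S := by
    refine ⟨hκ1, LipschitzWith.of_dist_le_mul fun x x' => ?_⟩
    rw [dist_eq_norm, dist_eq_norm, hκ]
    have he : S x - S x' = M (D (x' - x)) := by
      simp only [hS, map_sub]
      abel
    rw [he]
    calc ‖M (D (x' - x))‖ ≤ K * ‖D (x' - x)‖ := hMK _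
      _ ≤ K * (g α * ‖x' - x‖) :=
          mul_le_mul_of_nonneg_left
            ((D.le_opNorm _).trans (mul_le_mul_of_nonneg_right hD (norm_nonneg _))) hKpos.le
      _ = K * g α * ‖x - x'‖ := by rw [norm_sub_rev]; ring
  obtain ⟨x, hx⟩ : ∃ x, S x = x := ⟨ContractingWith.fixedPoint S hcon, hcon.fixedPoint_isFixedPt⟩
  refine ⟨x, ?_⟩
  have h1 : F' ũ x = y - D x := by
    conv_lhs => rw [← hx]
    exact hLM _
  rw [hDdef, sub_apply, eq_sub_iff_add_eq, add_sub_cancel] at h1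
  exact h1

/-- **Non-degeneracy** (McKenna–Pacella–Plum–Roth, arXiv:1210.5893, Thm. 3.1 (c): "`‖u − ω‖ ≤ α ⟹
L_{(λ,u)}` is bijective"), abstract form: under (16.7), `L` onto, (16.8) on the ball and (16.15), the
linearization `F'(ũ + u)` is bijective for every `‖u‖ ≤ α` — in particular at the zero found by
`exists_zero_of_integral_majorant`. [cite: Rump2010Verification, §16.1 (16.7), (16.8), (16.15); arXiv:1210.5893 Thm. 3.1 (c)] -/
theorem bijective_fderiv_of_majorant [CompleteSpace X] {F' : X → X →L[ℝ] Y} {ũ : X} {g : ℝ → ℝ}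
    {K α : ℝ} (hK : ∀ u : X, ‖u‖ ≤ K * ‖F' ũ u‖) (hL : Function.Surjective (F' ũ))
    (hg : ∀ u : X, ‖u‖ ≤ α → ‖F' (ũ + u) - F' ũ‖ ≤ g ‖u‖) (hmono : MonotoneOn g (Icc 0 α))
    (hKg : K * g α < 1) {u : X} (hu : ‖u‖ ≤ α) : Function.Bijective (F' (ũ + u)) := by
  refine ⟨fun x₁ x₂ h => ?_, surjective_fderiv_of_majorant hK hL hg hmono hKg hu⟩
  have hb := norm_le_mul_norm_fderiv_of_majorant hK hg hmono hKg hu (x₁ - x₂)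
  rw [map_sub, h, sub_self, norm_zero, mul_zero] at hb
  exact sub_eq_zero.1 (norm_le_zero_iff.1 hb)

/-- **"The dual and symmetric case"** of [Rump2010Verification] §16.1 (preprint p. 130): let `H` be a real
Hilbert space and `L : H → H'` bounded linear into the dual with (16.7) `‖u‖ ≤ K‖L[u]‖` and the symmetry
(16.13) `(L[u])[v] = (L[v])[u]`.  Then `L` is onto: "This implies the denseness of the range [...]: given any
`u` in its orthogonal complement, we have, for all `v`, `0 = ⟨u, (Φ⁻¹L)[v]⟩ = ⟨(Φ⁻¹L)[u], v⟩`, and hence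
[...] `L[u] = 0` and thus `u = 0` by (16.7). [...] it remains to show that `L(X) ⊂ X'` is closed [...] (16.7)
shows that `(uₙ)` is a Cauchy sequence".  Here `Φ⁻¹L` is Mathlib's `continuousLinearMapOfBilin L` and the
closed-range step is `AntilipschitzWith.isClosed_range` (the pattern of `IsCoercive.range_eq_top`).
[cite: Rump2010Verification, §16.1 case (2), eqs. (16.11)–(16.13) (preprint p. 130)] -/
theorem surjective_of_symmetric_of_norm_le_mul {H : Type*} [NormedAddCommGroup H]
    [InnerProductSpace ℝ H] [CompleteSpace H] {L : H →L[ℝ] H →L[ℝ] ℝ} {K : ℝ}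
    (hsymm : ∀ u v : H, L u v = L v u) (hK : ∀ u : H, ‖u‖ ≤ K * ‖L u‖) :
    Function.Surjective L := by
  set A : H →L[ℝ] H := InnerProductSpace.continuousLinearMapOfBilin (𝕜 := ℝ) L with hA
  have hAinner : ∀ v w : H, ⟪A v, w⟫_ℝ = L v w := fun v w =>
    InnerProductSpace.continuousLinearMapOfBilin_apply (𝕜 := ℝ) L v w
  -- `‖L v‖ ≤ ‖A v‖` (in fact equality: `A = Φ⁻¹ L` with `Φ` the Riesz isometry)
  have hnormA : ∀ v, ‖L v‖ ≤ ‖A v‖ := by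
    intro v
    refine ContinuousLinearMap.opNorm_le_bound _ (norm_nonneg _) fun w => ?_
    rw [← hAinner v w, Real.norm_eq_abs]
    exact abs_real_inner_le_norm _ _
  -- `A` is antilipschitz, hence has closed range
  obtain ⟨K', hK'⟩ : ∃ K' : NNReal, (K' : ℝ) = max K 0 := ⟨⟨max K 0, le_max_right _ _⟩, rfl⟩
  have hK'A : ∀ u : H, ‖u‖ ≤ K' * ‖A u‖ := fun u => by
    rw [hK']
    exact (hK u).trans ((mul_le_mul_of_nonneg_right (le_max_left K 0) (norm_nonneg _)).trans
      (mul_le_mul_of_nonneg_left (hnormA u) (le_max_right K 0)))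
  have hanti : AntilipschitzWith K' A := ContinuousLinearMap.antilipschitz_of_bound A hK'A
  have hclosed : IsClosed (A.range : Set H) := hanti.isClosed_range A.uniformContinuous
  -- the range of `A` is dense, hence everything
  have hrange : A.range = ⊤ := by
    haveI := hclosed.completeSpace_coe
    rw [← A.range.orthogonal_orthogonal, Submodule.eq_top_iff']
    intro v w hw
    obtain rfl : w = 0 := by
      have h0 : ∀ w' : H, L w w' = 0 := fun w' => by
        rw [hsymm w w', ← hAinner w' w]
        exact hw (A w') ⟨w', rfl⟩
      have hLw : L w = 0 := ContinuousLinearMap.ext fun w' => by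
        rw [h0, zero_apply]
      have hw0 : ‖w‖ ≤ 0 := by
        have h := hK w
        rw [hLw, norm_zero, mul_zero] at h
        exact h
      exact norm_le_zero_iff.1 hw0
    exact inner_zero_left _
  -- conclude: `L = Φ ∘ A`
  intro ℓ
  have hmem : (InnerProductSpace.toDual ℝ H).symm ℓ ∈ A.range := by
    rw [hrange]; trivial
  obtain ⟨v, hv⟩ := LinearMap.mem_range.1 hmem
  refine ⟨v, ContinuousLinearMap.ext fun w => ?_⟩
  have hv' : A v = (InnerProductSpace.toDual ℝ H).symm ℓ := hv
  rw [← hAinner v w, hv', InnerProductSpace.toDual_symm_apply]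

/-- **Theorem 16.1 of [Rump2010Verification] in "the dual and symmetric case" (2)**, verbatim: `H` a real
Hilbert space, `F : H → H'` Fréchet differentiable on `B̄_α(ũ)`, `L = F'(ũ)` with (16.6) `‖F(ũ)‖ ≤ δ`,
(16.7) `‖u‖ ≤ K‖L[u]‖`, (16.13) `(L[u])[v] = (L[v])[u]`, (16.8) on the ball with `g` non-decreasing,
(16.14) `δ ≤ α/K − ∫₀^α g` and (16.15) `K g(α) < 1`: "there exists a solution `u ∈ X` of the equation
`F(u) = 0` satisfying `‖u − ũ‖_X ≤ α`", unique in that ball.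
[cite: Rump2010Verification, §16.1 Thm. 16.1 case (2)] -/
theorem exists_zero_of_integral_majorant_of_symmetric {H : Type*} [NormedAddCommGroup H]
    [InnerProductSpace ℝ H] [CompleteSpace H] {F : H → (H →L[ℝ] ℝ)}
    {F' : H → H →L[ℝ] H →L[ℝ] ℝ} {ũ : H} {g : ℝ → ℝ} {δ K α : ℝ} (hα : 0 ≤ α)
    (hF : ∀ x ∈ closedBall ũ α, HasFDerivAt F (F' x) x)
    (hδ : ‖F ũ‖ ≤ δ) (hK : ∀ u : H, ‖u‖ ≤ K * ‖F' ũ u‖)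
    (hsymm : ∀ u v : H, F' ũ u v = F' ũ v u)
    (hg : ∀ u : H, ‖u‖ ≤ α → ‖F' (ũ + u) - F' ũ‖ ≤ g ‖u‖)
    (hmono : MonotoneOn g (Icc 0 α))
    (h₁ : δ ≤ α / K - ∫ s in (0 : ℝ)..α, g s) (h₂ : K * g α < 1) :
    ∃ u ∈ closedBall ũ α, F u = 0 ∧ ∀ u' ∈ closedBall ũ α, F u' = 0 → u' = u :=
  exists_zero_of_integral_majorant hα hF hδ hK (surjective_of_symmetric_of_norm_le_mul hsymm hK)
    hg hmono h₁ h₂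

end Literature.Analysis.Calculus

end
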